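import Mathlib
import Summits.ResolutionOfSingularities.ResolutionOfSingularities.Theorems.WeightedInvariantLocalWeightedDropTOT2CurveConflictDivTwo
import Summits.ResolutionOfSingularities.ResolutionOfSingularities.Theorems.WeightedInvariantLocalWeightedDropWildMonicFlagDropTools

/-!
# `LocalWeightedDrop`, TOT2-LINE regime (P), piece (P3) transport table — CONVERSE OF (F6): no new `u₁`-graphs at the `V(y,u₂)`-curve move

Crux item stmt-ResolutionOfSingularities-8899 `WeightedInvariant.LocalWeightedDrop` (route `ResolutionOfSingularities/WeightedInvariant`), ENGINE
skeleton v34 (80c4710965b6845c), registered stub `stub_regimePresented`, piece (P3) (res-type-088's conflict budget: CONVERSE laws of the transport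
table, S-CRV-D-DESIGN.md ADDENDUM v2.5 «remaining converses: …, curve moves, …»; forward law (F6) = `TOT2Curve.graph_divTwoT`, …TOT2CurveConflictDivTwo
p536462).  [OURS · L1 W4.3 · chain w43 · seat res-L1-w43-stub-1 gen 6; def-free; HOMOGENEITY of the Taylor shift (`WildMonic.shift_scale`): in the
sheared coordinates the label `A` is the `(ũ₂ + u₁h)`-scaling of `shearT h (divTwoT d A)`, so a datum `(h, φ′)` upstairs gives the datum
`(h, (ũ₂ + u₁h)·φ′)` downstairs — no position, no `h ≠ 0`, no coprimality needed in this direction; nothing here is a statement of any manuscript;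
AI-produced, gate-checked, weaker than expert review.]

* `shearT_eq_scale_divTwoT` — `shearT h A j = (X 1 + X 0·h)^{d−j} · shearT h (divTwoT d A) j` for `V(y,u₂)`-permissible `A`;
* **`graph_of_divTwoT`** — `IsPermissibleTwoT d A →` a permissible graph curve of `divTwoT d A` with datum `h` (any `h`, any re-centring `φ′`)
  gives a permissible graph curve of `A` with the SAME datum `h` and re-centring `(ũ₂ + u₁h)·φ′`;
* `hasGraphCurveT_of_divTwoT` — predicate form; with (F6) the u₁-graph data with `h ≠ 0` of `A` and `divTwoT d A` coincide (M2-row of the budget).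
-/

set_option linter.dupNamespace false -- mandated namespace of this single-conjunct summit

noncomputable section

namespace Summit.ResolutionOfSingularities.ResolutionOfSingularities.Theorems

namespace TOT2Curve

open MvPowerSeries PolyDescent MonicDescent WildMonic Literature.AlgebraicGeometry.Resolution

variable {k : Type} [Field k] {d : ℕ}

/-- In the sheared coordinates, `A` is the `(ũ₂ + u₁h)`-scaling of `shearT h (divTwoT d A)` (for `V(y,u₂)`-permissible `A`). -/
theorem shearT_eq_scale_divTwoT (A : Fin d → MvPowerSeries (Fin 2) k) (hA2 : IsPermissibleTwoT d A) (h : MvPowerSeries (Fin 2) k) :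
    shearT h A = fun j : Fin d => (X 1 + X 0 * h) ^ (d - (j : ℕ)) * shearT h (divTwoT d A) j := by
  funext j
  show shear h (A j) = (X 1 + X 0 * h) ^ (d - (j : ℕ)) * shear h (divTwo (d - (j : ℕ)) (A j))
  conv_lhs => rw [← X_pow_mul_divTwo (d - (j : ℕ)) (A j) (hA2 j)]
  rw [shear_X_one_pow_mul]

/-- **CONVERSE OF (F6) — NO NEW `u₁`-GRAPHS AT THE `V(y,u₂)`-MOVE.**  If `V(y,u₂)` is permissible for `A` and the curve chart `divTwoT d A`
carries a permissible graph curve `V(y + φ′, u₂ + u₁h)`, then `A` carries the permissible graph curve `V(y + (u₂ + u₁h)·φ′, u₂ + u₁h)` — the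
same datum `h` (by homogeneity of the Taylor shift). -/
theorem graph_of_divTwoT (A : Fin d → MvPowerSeries (Fin 2) k) (hA2 : IsPermissibleTwoT d A) (h φ' : MvPowerSeries (Fin 2) k)
    (hperm' : IsPermissibleTwoT d (shift d (shearT h (divTwoT d A)) φ')) :
    ∃ ψ : MvPowerSeries (Fin 2) k, constantCoeff ψ = 0 ∧ IsPermissibleTwoT d (shift d (shearT h A) ψ) := by
  refine ⟨(X 1 + X 0 * h) * φ', by rw [map_mul, map_add, map_mul, constantCoeff_X, constantCoeff_X, zero_mul, add_zero, zero_mul], ?_⟩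
  rw [isPermissibleTwoT_iff_X_pow_dvd] at hperm' ⊢
  intro j
  rw [shearT_eq_scale_divTwoT A hA2 h, shift_scale]
  exact Dvd.dvd.mul_left (hperm' j) _

/-- Predicate form: a graph curve of `divTwoT d A` (for `V(y,u₂)`-permissible `A`) comes from a graph curve of `A` with the same datum. -/
theorem hasGraphCurveT_of_divTwoT (A : Fin d → MvPowerSeries (Fin 2) k) (hA2 : IsPermissibleTwoT d A) (hG : HasGraphCurveT d (divTwoT d A)) :
    HasGraphCurveT d A := by
  obtain ⟨h, φ', hh, -, hperm'⟩ := hG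
  obtain ⟨ψ, hψ, hperm⟩ := graph_of_divTwoT A hA2 h φ' hperm'
  exact ⟨h, ψ, hh, hψ, hperm⟩

/-- **THE u₁-GRAPH DATA WITH `h ≠ 0` ARE INVARIANT UNDER THE `V(y,u₂)`-MOVE** (for a position with `V(y,u₂)` permissible): (F6) and its
converse. -/
theorem graphData_divTwoT_eq (hd : 0 < d) (A : Fin d → MvPowerSeries (Fin 2) k) (hA : IsPosT d A) (hA2 : IsPermissibleTwoT d A) :
    {h : MvPowerSeries (Fin 2) k | (∀ e : Fin 2 →₀ ℕ, e 1 ≠ 0 → coeff e h = 0) ∧ h ≠ 0 ∧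
        ∃ φ : MvPowerSeries (Fin 2) k, constantCoeff φ = 0 ∧ IsPermissibleTwoT d (shift d (shearT h (divTwoT d A)) φ)} =
      {h : MvPowerSeries (Fin 2) k | (∀ e : Fin 2 →₀ ℕ, e 1 ≠ 0 → coeff e h = 0) ∧ h ≠ 0 ∧
        ∃ φ : MvPowerSeries (Fin 2) k, constantCoeff φ = 0 ∧ IsPermissibleTwoT d (shift d (shearT h A) φ)} := by
  ext h
  constructor
  · rintro ⟨hh, hh0, φ', -, hperm'⟩
    exact ⟨hh, hh0, graph_of_divTwoT A hA2 h φ' hperm'⟩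
  · rintro ⟨hh, hh0, φ, -, hperm⟩
    exact ⟨hh, hh0, graph_divTwoT hd A hA hA2 h φ hh hh0 hperm⟩

end TOT2Curve

end Summit.ResolutionOfSingularities.ResolutionOfSingularities.Theorems

end
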